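import Mathlib
import Literature.MathematicalPhysics.StatisticalMechanics.Crystallization
import Literature.MathematicalPhysics.StatisticalMechanics.BarlowStacking
import Literature.MathematicalPhysics.StatisticalMechanics.HaggStacking
import Literature.MathematicalPhysics.StatisticalMechanics.MuGroundStateConfiguration
import Literature.MathematicalPhysics.StatisticalMechanics.HardCoreGSC
import Literature.Geometry.DiscreteGeometry.KissingPatterns

/-!
# Sketch — crux stmt-AtomisticToContinuum-13603 (`ReggeStarCoercivity.DefectFreeCrystallizes`),
# ideator 3 (gen 2), round 1

First lemmas of the two crux-idea cards filed this round (they need not be proved; they must elaborate):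

* card `affine-somewhere-suffices`:
  - `PeriodisationBound` — THE FREE LOWER HALF OF THE WINDOW BUDGET: for every configuration of `N ≥ 1`
    DISTINCT points of `ℝ³`, `N · e_per ≤ 𝓔_N(x)` where `e_per = ⨅` over periodic configurations of the
    Lennard-Jones energy per particle. Proof (provable now, modulo `CrysPeriodicBddBelow` = shared item
    0714 for `ciInf_le`): periodise the cluster with period lattice `L ℤ³`, `L = diam + 1`; every cross
    distance is `≥ 1 > 2^{-1/6}`, where `V_LJ < 0`, so `e(P_x) ≤ 𝓔_N(x)/N`, and `e_per ≤ e(P_x)`.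
    Applied to ground states it gives `E(N) ≥ N e_per` for all `N` (hence, with `BlancLewin2015_8_holds`
    and `CrysEnergyUpper`, the shared bookkeeping item 0626 `CrysEnergyLimit`); applied to a WINDOW
    `W ⊂ x^N` it is the lower bound `E_self(W) ≥ |W| e_per` that the card squeezes against the
    cut-and-paste cap `E_self(W) ≤ |W| e_per + o(|W|) + C R²`.
  - `NearAffineLayeredWindows` — the TRANSFER TARGET (G'): along a ground-state sequence with zero
    1/20-defect density, for every radius and tolerance, frequently in `N`, SOME window is two-way matched
    with an AFFINE image (any strain in the funnel) of an exact layered close-packed configuration with a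
    FREE Hägg word and FREE interlayer gaps. No optimality of strain, word or gaps is asked.
  - `AffineToIsometric` — the shape of the free upgrade the budget arithmetic performs:
    (G') ⇒ near-ISOMETRIC layered windows with spacing in the live box (the conclusion of card
    own-word-squeeze's `DefectFreeLayered`, i.e. of `HullMinimality.LayeredWindows`, stmt-11778).
* card `critical-point-rigidity`:
  - `GoodAt` — the crux's defect predicate for a point of an infinite configuration (set version,
    limit-stable cutoff `59/50` in place of `6/5`, same `[9/10, 11/10]`, `1/20`).
  - `GoodGscRigidity` — every non-empty, uniformly discrete, EVERYWHERE-GOOD hard-core ground state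
    configuration (Sütő GSC: no particle-conserving finite modification lowers the energy) of
    Lennard-Jones in `ℝ³` is an affine image of an exact layered close-packed configuration
    (in-plane homogeneous, exact registry, some Hägg word, some gap profile). Criticality + local
    minimality, not the energy VALUE, straighten the crystal; the word and the cell are then decided by
    finite-dimensional tables and the shared 1-D stacking machinery.
-/

noncomputable section

open scoped BigOperators RealInnerProductSpace
open Filter Topology

namespace Summit.AtomisticToContinuum.Crystallization.Cruxes.DefectFreeCrystallizes.Ideator3G2

open Literature.MathematicalPhysics.StatisticalMechanics Literature.Geometry.DiscreteGeometry

local notation "E3" => EuclideanSpace ℝ (Fin 3)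

/-! ## Shared vocabulary -/

/-- Number of 1/20-defective sites of a finite configuration — VERBATIM the sub-expression of the crux
`ReggeStarCoercivity.DefectFreeCrystallizes` / `ZeroDefectDensity`. -/
def defectCard (N : ℕ) (y : Fin N → E3) : ℕ :=
  Nat.card {i : Fin N // ¬ ∃ a : ℝ, 9 / 10 ≤ a ∧ a ≤ 11 / 10 ∧
    (ShellCloseTo (1 / 20) ((Finset.univ.filter fun j : Fin N => j ≠ i ∧ dist (y i) (y j) ≤ 6 / 5).image
        fun j => a⁻¹ • (y j - y i)) fccKissingPattern ∨
      ShellCloseTo (1 / 20) ((Finset.univ.filter fun j : Fin N => j ≠ i ∧ dist (y i) (y j) ≤ 6 / 5).image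
        fun j => a⁻¹ • (y j - y i)) hcpKissingPattern)}

/-- Sanity: `defectCard` is literally the crux's defect count. -/
example (x : (N : ℕ) → (Fin N → E3)) :
    (Tendsto (fun N : ℕ => (defectCard N (x N) : ℝ) / N) atTop (𝓝 0)) =
    (Tendsto (fun N : ℕ => (Nat.card {i : Fin N // ¬ ∃ a : ℝ, 9 / 10 ≤ a ∧ a ≤ 11 / 10 ∧
      (ShellCloseTo (1 / 20) ((Finset.univ.filter fun j : Fin N => j ≠ i ∧ dist (x N i) (x N j) ≤ 6 / 5).image
        fun j => a⁻¹ • (x N j - x N i)) fccKissingPattern ∨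
      ShellCloseTo (1 / 20) ((Finset.univ.filter fun j : Fin N => j ≠ i ∧ dist (x N i) (x N j) ≤ 6 / 5).image
        fun j => a⁻¹ • (x N j - x N i)) hcpKissingPattern)} : ℝ) / N) atTop (𝓝 0)) := rfl

/-- The exact LAYERED close-packed configuration with unit in-plane spacing, Hägg word `s` and FREE layer
heights `z : ℤ → ℝ`: layer `m` is the unit triangular lattice shifted laterally by `haggLabel s m • w`
(hole registry) and placed at height `z m`. For `z m = m h` this is `barlowStacking 1 h s`. -/
def layeredSet (s : ℤ → ℤ) (z : ℤ → ℝ) : Set E3 :=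
  {p | ∃ m i j : ℤ, p = (i : ℝ) • triangularVec₁ 1 + (j : ℝ) • triangularVec₂ 1 +
    (haggLabel s m : ℝ) • barlowOffset 1 + z m • layerNormal 1}

/-- The periodic infimum `e_per = ⨅_Q e(Q)` of the Lennard-Jones energy per particle in `ℝ³`. -/
def ePer : ℝ := ⨅ Q : PeriodicConfiguration 3, Q.energyPerParticle lennardJones

/-! ## Card `affine-somewhere-suffices` -/

/-- **First lemma 1 (PeriodisationBound).** `N · e_per ≤ 𝓔_N(x)` for every configuration of distinct
points (no ground-state hypothesis, no error term). With `CrysPeriodicBddBelow` (item 0714) the proof is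
the periodisation `P_x = range x + (diam x + 1) ℤ³`: all cross terms sit at distances `≥ 1 > 2^{-1/6}` where
`lennardJones < 0`, so `e_per ≤ e(P_x) ≤ 𝓔_N(x) / N`. It is `StarCoercivity` (route item 13600) with the
defect term dropped AND `C = 0`, and the free lower half of the window budget. -/
def PeriodisationBound : Prop :=
  ∀ (N : ℕ) (x : Fin N → E3), Function.Injective x → (N : ℝ) * ePer ≤ interactionEnergy lennardJones x

/-- Admissible affine maps of the funnel: within `1/5` (relative operator norm) of a similarity
`lam • R`, `lam ∈ [17/20, 6/5]` — covers the crux's scale window `[9/10, 11/10]` and its `≈ 10 %` strain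
blindness (`Negative/StrainBlindness.lean`). -/
def AdmissibleAffine (A : E3 →L[ℝ] E3) : Prop :=
  ∃ (R : E3 ≃ₗᵢ[ℝ] E3) (lam : ℝ), 17 / 20 ≤ lam ∧ lam ≤ 6 / 5 ∧
    ‖A - lam • (R.toContinuousLinearEquiv : E3 →L[ℝ] E3)‖ ≤ lam / 5

/-- (G') for ONE sequence `x`: near-affine layered windows exist at every scale — frequently in `N`, some
translate of `x N` is two-way `ε`-matched on `‖·‖ ≤ R` with `A '' layeredSet s z` for SOME admissible
affine `A`, SOME Hägg word `s` and SOME gap profile `z` (gaps merely in `[3/5, 1]` so that the set is a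
stack of separated layers). Nothing optimal is asked of `A`, `s`, `z`. -/
def NearAffineLayeredWindowsFor (x : (N : ℕ) → (Fin N → E3)) : Prop :=
  ∀ R ε : ℝ, 0 < ε → ∃ᶠ N in atTop,
    ∃ (A : E3 →L[ℝ] E3) (t : E3) (s : ℤ → ℤ) (z : ℤ → ℝ), AdmissibleAffine A ∧ IsHaggSeq s ∧
      (∀ m : ℤ, 3 / 5 ≤ z (m + 1) - z m ∧ z (m + 1) - z m ≤ 1) ∧
      BallMatch ε R 0 (Set.range fun i : Fin N => x N i + t) (A '' layeredSet s z)

/-- **First lemma 2 (NearAffineLayeredWindows, the transfer target (G')).** Along every Lennard-Jones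
ground-state sequence with zero 1/20-defect density, near-affine layered windows exist at every scale. -/
def NearAffineLayeredWindows : Prop :=
  ∀ x : (N : ℕ) → (Fin N → E3), (∀ N, IsGroundState lennardJones (x N)) →
    Tendsto (fun N : ℕ => (defectCard N (x N) : ℝ) / N) atTop (𝓝 0) →
    NearAffineLayeredWindowsFor x

/-- Near-ISOMETRIC layered windows with in-plane spacing and gaps in the live box — the conclusion of
`HullMinimality.LayeredWindows` (stmt-11778) / card own-word-squeeze's `DefectFreeLayered`, per sequence. -/
def IsometricLayeredWindowsFor (x : (N : ℕ) → (Fin N → E3)) : Prop :=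
  ∃ a : ℝ, 47 / 50 ≤ a ∧ a ≤ 1 ∧ ∀ R ε : ℝ, 0 < ε → ∃ᶠ N in atTop,
    ∃ (A : E3 →ₗᵢ[ℝ] E3) (t : E3) (s : ℤ → ℤ) (z : ℤ → ℝ), IsHaggSeq s ∧
      (∀ m : ℤ, 39 / 50 * a ≤ z (m + 1) - z m ∧ z (m + 1) - z m ≤ 17 / 20 * a) ∧
      BallMatch ε R 0 (Set.range fun i : Fin N => x N i + t)
        ((fun p => A (a • p)) '' layeredSet s (fun m => a⁻¹ * z m))

/-- **The free upgrade (AffineToIsometric).** For ground-state sequences, (G') already gives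
near-isometric layered windows in the live box: the two-sided window budget
`|W| e_per ≤ E_self(W) ≤ |W| e_per + o(|W|) + C R²` (PeriodisationBound below / cut-and-paste above),
the Lipschitz continuity of `E_self` under `ε`-matchings, and the finite-dimensional ANISOTROPY TABLE
(`e(A '' layered) − e(conformal part '' layered) ≥ c · dist(A, ℝ₊·O(3))²` over the box; kit j008984) force
`dist(A, ℝ₊·O(3)) → 0` and the conformal factor into the box along the diagonal sequence — no coercivity
inequality over inhomogeneous configurations is ever used. -/
def AffineToIsometric : Prop :=
  ∀ x : (N : ℕ) → (Fin N → E3), (∀ N, IsGroundState lennardJones (x N)) →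
    NearAffineLayeredWindowsFor x → IsometricLayeredWindowsFor x

/-! ## Card `critical-point-rigidity` -/

/-- The crux's defect predicate for a point `p` of an infinite configuration `X` (set version), in its
LIMIT-STABLE form: the other points of `X` within `59/50` of `p` are finitely many and, recentred and
rescaled by some `a ∈ [9/10, 11/10]`, `1/20`-close after a linear isometry to the fcc or the hcp kissing
pattern. Cutoff `59/50` instead of the crux's `6/5`: by radial pinning (`Negative/PredicateAPI`,
`Good.exists_annulus`) a `1/20`-good site of an injective configuration has its twelve shell points within
`231/200 < 59/50` and NO other point within `6/5`, so good-at-`6/5` implies good-at-`59/50` sitewise, while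
good-at-`59/50` passes to local limits of uniformly discrete configurations (the annulus
`(231/200, 6/5]` is empty before the limit, hence `(231/200, 6/5)` is empty after it) — this dodges the trap
`good_not_closed` of Disproof §3 (a 13th particle converging to distance exactly `6/5`). -/
def GoodAt (X : Set E3) (p : E3) : Prop :=
  ∃ hfin : Set.Finite ((X ∩ Metric.closedBall p (59 / 50)) \ {p}), ∃ a : ℝ, 9 / 10 ≤ a ∧ a ≤ 11 / 10 ∧
    (ShellCloseTo (1 / 20) (hfin.toFinset.image fun q => a⁻¹ • (q - p)) fccKissingPattern ∨
      ShellCloseTo (1 / 20) (hfin.toFinset.image fun q => a⁻¹ • (q - p)) hcpKissingPattern)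

/-- **First lemma 3 (GoodGscRigidity) — the rigidity statement the critical-point line must prove.**
A non-empty, uniformly discrete configuration of `ℝ³` that is GOOD AT EVERY POINT and is a hard-core
ground state configuration of Lennard-Jones (no particle-conserving finite modification lowers the
energy: `IsHardCoreGSC`) is an affine image of an exact layered close-packed configuration: in-plane
homogeneous, exactly registered, with SOME Hägg word and SOME gap profile. (Expected proof: first and
second variation — force balance and stability — make the discrete strain field solve a uniformly
elliptic system whose chart-free Liouville theorem (F. John's BMO bound on the frame field + Campanato
iteration fed by the GLOBAL sup-bound that goodness provides) kills in-plane inhomogeneity, bending and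
winding; the monotone interlayer force (kit j008962) kills gap modulations by a maximum principle.
Homogeneously compressed exact stackings ARE hard-core GSCs, hence the affine `A`.) -/
def GoodGscRigidity : Prop :=
  ∀ X : Set E3, X.Nonempty → UniformlyDiscrete X → (∀ p ∈ X, GoodAt X p) →
    IsHardCoreGSC lennardJones X →
      ∃ (A : E3 →L[ℝ] E3) (t : E3) (s : ℤ → ℤ) (z : ℤ → ℝ), Function.Injective A ∧ IsHaggSeq s ∧
        X = (fun p => A p + t) '' layeredSet s z

/-- Sanity (shape only): `layeredSet` with linear heights is the tree's Barlow stacking at unit spacing. -/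
theorem layeredSet_linear (s : ℤ → ℤ) (h : ℝ) :
    layeredSet s (fun m => (m : ℝ) * h) = barlowStacking 1 h s := by
  ext p
  simp only [layeredSet, barlowStacking, barlowPos, Set.mem_setOf_eq, layerNormal]
  constructor
  · rintro ⟨m, i, j, rfl⟩
    refine ⟨m, i, j, ?_⟩
    congr 1
    ext k
    fin_cases k <;> simp
  · rintro ⟨m, i, j, rfl⟩
    refine ⟨m, i, j, ?_⟩
    congr 1
    ext k
    fin_cases k <;> simp

end Summit.AtomisticToContinuum.Crystallization.Cruxes.DefectFreeCrystallizes.Ideator3G2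

end
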